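/-
Copyright (c) 2026 the pub-hodgecm-mathlib formalisation cell (harness21).  Prover seat hodgecm-mathlib-K2E3-p32 (g0), HCML Track B «K2-LIT» (close-out strike line L4
`stub_StCharTS`), h413 = `stmt-HodgeConjecture-24833`, line `K2_E3_EllipticInputs`, unit U4 «Keys», PART «U4Keys» socket :155 (U4f-χ₁-ram-one-d0B)
`sig_K2E3KeysThmTwoContractingRamifiedCharOneDepthZeroNormTrivial` (LINE-LEAD K2E3-plan (g5), deal D162 «d0B lead ∕ consumer», cell «U4-RAM»; plan of record K2E3-p06 (g4)
DESIGN-M2-v2 (O2) ∕ PAPER-Z3-DepthZeroInert §1; Z3-c SHARED FRAME v1 (K2E3-p03 (g9))): THE ★ CONSTANT HALF OF THE END ASSEMBLY'S HYPOTHESES, DISCHARGED ON `U(Φ₃)(L⁺_v)` —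
`Λ_1 f_w = V`, `Λ_{w₀} f₁ = q⁻³ V`, their integrabilities, `V = μ(N₀) ≠ 0`, `|Y| = |χ₁(ϖ̂)| < 1`.  2026-09-04.
-/
import Summits.HodgeConjecture.HodgeConjecture.Theorems.K2E3BranchBCasselmanPairConstants   -- ★ (K2E3-p26∕p03) `integral_toFun_weyl_mul_eq`, `integrable_toFun_weyl_mul`, `integral_toFun_conj_eq`, `integrable_toFun_conj` (generic `t, τ, θ`)
import Summits.HodgeConjecture.HodgeConjecture.Theorems.K2E3BranchBHaarFactsN               -- ★ (R90-C10-p04) `measurableSet_setOf_coe_mem`, `…_conj_mem`, `measure_setOf_…_lt_top`, `isOpen_setOf_coe_mem`, `measureReal_setOf_conj_mem_eq` (`q⁻³`)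
import Summits.HodgeConjecture.HodgeConjecture.Theorems.K2E3IwahoriCellMembership          -- ★ `theta_eq_one_of_mem_N`
import Summits.HodgeConjecture.HodgeConjecture.Theorems.K2E3BranchALettersCM               -- ★ (K2E3-p06) `theta_conj_eq_one`
import Summits.HodgeConjecture.HodgeConjecture.Theorems.K2E3BranchBTypeBasisCM              -- ★ (this seat) the normalised basis; brings the (G3)-frame, `locallyCompactSpace_cmBorelU`, the inducing character
import Literature.NumberTheory.Automorphic.NonsplitPlaceHaarBallRatios                      -- ★ `isUnit_toLocalRing_uniformizer`, `unitModulusChar_toLocalRing_uniformizer`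
import HarnessLib

/-!
# K2 ∕ E3 «EllipticInputs», unit U4 «Keys» — (U4f-χ₁-ram-one-d0B) THE CONSTANT HALF OF THE END ASSEMBLY'S HYPOTHESES, DISCHARGED:
# `Λ_1 f_w = μ(N₀)`, `Λ_{w₀} f₁ = q⁻³·μ(N₀)` (inert), the two integrabilities, `μ(N₀) > 0`, and `|χ₁(ϖ̂)| < 1` — on `U(Φ₃)(L⁺_v)`, for the inducing character of `i(χ₁, 1)`
# [Casselman1980 §3; Casselman1995 §6.4; Keys1984 §7 Thm (2); Rogawski1990 §4.9, §12.2]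

Cell `pub/hodgecm-mathlib`, crux H413 = `stmt-HodgeConjecture-24833`, route of record `HCCMUnconditional`; chair K2-lead (g2), LINE-LEAD∕dealer K2E3-plan (g5), architect K2E3-p25
(g3); cell «U4-RAM» (Z3-c frame v1, K2E3-p03 (g9)).  THEOREMS ONLY (no `def`, no `instance`, no `notation`, no named-fact hypothesis, no `sorry`); lane
`--supports stmt-HodgeConjecture-24833 --as helper`, count-neutral.  NOT THE PAYER.

THE POINT.  The end assembly 📤 `K2E3KeysThmTwoDepthZeroBranchBAssembly.exists_eta_of_reducible_of_pairEntries` (this seat) takes, for a normalised `(I, χ̃)`-type basis `(f₁, f_w)` of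
`i(χ₁, 1)` on `U(Φ₃)(L⁺_v)`, ten analytic letters: the four entries `h11v hwwv hw1v h1wv`, the four integrabilities `hi₁₁ hiw₁ hi₁₂ hiw₂`, `hV : V ≠ 0` and `hY : |Y| < 1`.  SIX of them
are ★ by name already, in the generic `(t, τ, θ)`-frame of ★ `K2E3BranchBCasselmanPairConstants` (K2E3-p26∕p03) and ★ `K2E3BranchBHaarFactsN` (R90-C10-p04); THIS FILE reads them on
the CM instance `t = cmBorelTriple`, `τ = χ̃·δ^{1∕2}`, `θ(b) = χ₁(b₀₀)` (★ `theta_eq_one_of_mem_N`, ★ `theta_conj_eq_one` discharge the two `hθ`), with `V := μ.real N₀`,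
`N₀ = {n ∈ N : n ∈ I}`, in exactly the assembly's spellings (`w₀ : U(Φ₃)(L⁺_v)`, integrands `n ↦ fᵢ(w₀ · n · g)`, `g ∈ {1, w₀}`):
* `integral_weyl_one_eq` (`hw1v`: `Λ_1 f_w = V`) and `integrable_weyl_one` (`hiw₁`);
* `integral_weyl_weyl_eq` (`h1wv`: `Λ_{w₀} f₁ = q⁻³·V` at an UNRAMIFIED `v`, ★ `measureReal_setOf_conj_mem_eq`) and `integrable_weyl_weyl` (`hi₁₂`);
* `measureReal_setOf_mem_pos` ∕ `measureReal_setOf_mem_ne_zero` (`hV`: `N₀` is open ★ and contains `1`, Haar measures are positive on open sets, `μ(N₀) < ∞` ★);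
* `norm_apply_uniformizer_lt_one` (`hY`: contraction + ★ `unitModulusChar_toLocalRing_uniformizer` `= q⁻² < 1`).
WHAT THEN REMAINS of the ten: `h11v`, `hwwv`, `hi₁₁`, `hiw₂` — the two BIG-CELL entries `G₁ = Λ_1 f₁`, `G₂ = Λ_{w₀} f_w` and their integrability = (II)-a∕(II)-b∕(II)-c of the «U4-RAM» chain.
HONEST LABEL.  HC_CM is proved only modulo the 7 printed citations (2 remaining named inputs: hLiu418 = `stmt-HodgeConjecture-24832`, h413 = `stmt-HodgeConjecture-24833`) until rung 0
closes; count-neutral — this file does NOT pay the leaf; no printed citation is discharged.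

## References
* [Casselman1980] W. Casselman, Compositio Math. 40 (1980), §3.
* [Casselman1995] W. Casselman, *Introduction to the theory of admissible representations of `p`-adic reductive groups* (1995), §6.4.
* [Keys1984] D. Keys, Compositio Math. 51 (1984), §7 Theorem (2) p. 126.
* [Rogawski1990] J. Rogawski, Ann. of Math. Stud. 123 (1990), §4.9 p. 54, §12.2 p. 173.
-/

set_option autoImplicit false
-- the mandated namespace has the single-problem summit's repeated segment (`HodgeConjecture.HodgeConjecture`)
set_option linter.dupNamespace false

noncomputable section

open NumberField IsDedekindDomain MeasureTheory
open scoped Matrix MatrixGroups WithZero Valued NNReal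
open Literature.NumberTheory Literature.NumberTheory.Automorphic Literature.NumberTheory.Automorphic.UnitaryGroup
open Literature.NumberTheory.Rogawski1990

namespace Summit.HodgeConjecture.HodgeConjecture.Cruxes.H413.K2E3KeysThmTwoDepthZeroBranchBConstants

open Summit.HodgeConjecture.HodgeConjecture.Cruxes.H413
open Summit.HodgeConjecture.HodgeConjecture.Cruxes.H413.K2E3DepthZeroIwahoriCharacterCM
open Summit.HodgeConjecture.HodgeConjecture.Cruxes.H413.K2E3BranchATorusWitnessCM
open Summit.HodgeConjecture.HodgeConjecture.Cruxes.H413.K2E3BranchATypeLettersCM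

variable (L : Type) [Field L] [NumberField L] [IsCMField L] (v : HeightOneSpectrum (𝓞 ↥(maximalRealSubfield L)))
  (w : PlacesOver L v) (hw : IsCMField.complexConj L • w.1 = w.1)
  (eA : Gqs L v ≃ₜ* ↥(unitaryGroupOfForm (galAdicCompletionMap (L := L) (IsCMField.complexConj L) hw) ((StdForm.antidiagonal 3).over (w.1.adicCompletion L))))
  (heA : ∀ g : Gqs L v,
    ((eA g : ↥(unitaryGroupOfForm (galAdicCompletionMap (L := L) (IsCMField.complexConj L) hw) ((StdForm.antidiagonal 3).over (w.1.adicCompletion L)))) :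
        GL (Fin 3) (w.1.adicCompletion L)) =
      ((localNonsplitEquiv (IsCMField.complexConj L) (qsForm L) (IsCMField.complexConj_ne_one L) w hw g :
        ↥(unitaryGroupOfForm (galAdicCompletionMap (L := L) (IsCMField.complexConj L) hw) (placeForm (qsForm L) w.1))) : GL (Fin 3) (w.1.adicCompletion L)))
  {ϖ : w.1.adicCompletion L} (hϖ : Valued.v ϖ = WithZero.exp (-1 : ℤ))
  (g₁ : GL (Fin 3) (w.1.adicCompletion L)) (hg₁ : (g₁ : Matrix (Fin 3) (Fin 3) (w.1.adicCompletion L)) = Matrix.diagonal ![(1 : w.1.adicCompletion L), 1, ϖ])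
  (K0 K1 I : Subgroup (Gqs L v))
  (hK0 : K0 = ((glInt 3 (w.1.adicCompletion L)).subgroupOf
    (unitaryGroupOfForm (galAdicCompletionMap (L := L) (IsCMField.complexConj L) hw) ((StdForm.antidiagonal 3).over (w.1.adicCompletion L)))).comap
      eA.toMulEquiv.toMonoidHom)
  (hK1 : K1 = (((glInt 3 (w.1.adicCompletion L)).map (MulAut.conj g₁).toMonoidHom).subgroupOf
    (unitaryGroupOfForm (galAdicCompletionMap (L := L) (IsCMField.complexConj L) hw) ((StdForm.antidiagonal 3).over (w.1.adicCompletion L)))).comap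
      eA.toMulEquiv.toMonoidHom)
  (hI : I = K0 ⊓ K1)

/-! ## §1 `|Y| = |χ₁(ϖ̂)| < 1` (contraction) -/

include hw in
/-- **`|χ₁(ϖ̂)| < 1`** for a contracting `χ₁` at a non-split place unramified in `L`, `ϖ̂ = ` the uniformiser of `L⁺_v` read in `L_v` (★ `isUnit_toLocalRing_uniformizer`): its modulus is
`q⁻² < 1` (★ `unitModulusChar_toLocalRing_uniformizer`, `1 < q = N𝔭_v`).  The letter `hY` of the end assembly ∕ of ★ Z4. [cite: Keys1984, §7 Theorem (2) p. 126] [cite: Rogawski1990, §12.2 p. 173] -/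
theorem norm_apply_uniformizer_lt_one (hunr : Algebra.IsUnramifiedIn (𝓞 L) v.asIdeal) (χ₁ : (LocalRing L v)ˣ →* ℂˣ)
    (hcontr : ∀ x : (LocalRing L v)ˣ, unitModulusChar (LocalRing L v) x < 1 → ‖((χ₁ x : ℂˣ) : ℂ)‖ < 1) :
    ‖((χ₁ (isUnit_toLocalRing_uniformizer L v).unit : ℂˣ) : ℂ)‖ < 1 := by
  refine hcontr _ ?_
  rw [unitModulusChar_toLocalRing_uniformizer L v w hw hunr]
  have hq : (1 : ℝ≥0) < (Ideal.absNorm v.asIdeal : ℝ≥0) := by exact_mod_cast NumberField.HeightOneSpectrum.one_lt_absNorm v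
  exact inv_lt_one_of_one_lt₀ (one_lt_pow₀ hq two_ne_zero)

/-! ## §2 `V = μ(N₀) > 0` -/

include hw hK0 hK1 hI in
/-- **`μ(N₀) > 0`**, `N₀ = {n ∈ N(L⁺_v) : n ∈ I}`, for every Haar measure `μ` on `N(L⁺_v)`: `N₀` is open (★ `isOpen_setOf_coe_mem`, read on the `U(Φ₃)(L⁺_v)`-spelled carrier by
definitional unfolding), contains `1`, and has finite mass (★ `measure_setOf_coe_mem_lt_top`, instances handed over explicitly — the two spellings `Gqs L v` ∕ `U(Φ₃)(L⁺_v)` of the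
carrier agree by `rfl` but not at instance transparency). [cite: Casselman1980, §3] -/
theorem measureReal_setOf_mem_pos [instM : MeasurableSpace ↥(cmBorelTriple L 3 v).N] (μ : Measure ↥(cmBorelTriple L 3 v).N) [instH : μ.IsHaarMeasure] :
    0 < μ.real {m : ↥(cmBorelTriple L 3 v).N | (m : ↥(unitaryGroupOfForm (conjLocal L (IsCMField.complexConj L) v) (cmLocalForm L 3 v))) ∈ I} := by
  have hopen : IsOpen {m : ↥(cmBorelTriple L 3 v).N | (m : ↥(unitaryGroupOfForm (conjLocal L (IsCMField.complexConj L) v) (cmLocalForm L 3 v))) ∈ I} := K2E3BranchBHaarFactsN.isOpen_setOf_coe_mem L v w hw eA g₁ K0 K1 I hK0 hK1 hI (cmBorelTriple L 3 v)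
  have hpos := hopen.measure_pos μ ⟨1, show ((1 : ↥(cmBorelTriple L 3 v).N) : ↥(unitaryGroupOfForm (conjLocal L (IsCMField.complexConj L) v) (cmLocalForm L 3 v))) ∈ I from I.one_mem⟩
  have htop : μ {m : ↥(cmBorelTriple L 3 v).N | (m : ↥(unitaryGroupOfForm (conjLocal L (IsCMField.complexConj L) v) (cmLocalForm L 3 v))) ∈ I} < ⊤ :=
    @K2E3BranchBHaarFactsN.measure_setOf_coe_mem_lt_top L _ _ _ v w hw eA g₁ K0 K1 I hK0 hK1 hI (cmBorelTriple L 3 v) rfl instM μ instH.toIsFiniteMeasureOnCompacts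
  rw [measureReal_def]
  exact ENNReal.toReal_pos hpos.ne' htop.ne

include hw hK0 hK1 hI in
/-- **`(μ(N₀) : ℂ) ≠ 0`** — the letter `hV` of the end assembly with `V := μ.real N₀`. [cite: Casselman1980, §3] -/
theorem measureReal_setOf_mem_ne_zero [MeasurableSpace ↥(cmBorelTriple L 3 v).N] (μ : Measure ↥(cmBorelTriple L 3 v).N) [μ.IsHaarMeasure] :
    ((μ.real {m : ↥(cmBorelTriple L 3 v).N | (m : ↥(unitaryGroupOfForm (conjLocal L (IsCMField.complexConj L) v) (cmLocalForm L 3 v))) ∈ I} : ℝ) : ℂ) ≠ 0 :=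
  Complex.ofReal_ne_zero.2 (measureReal_setOf_mem_pos L v w hw eA g₁ K0 K1 I hK0 hK1 hI μ).ne'

/-! ## §3 `Λ_1 f_w = μ(N₀)` and its integrability, on `U(Φ₃)(L⁺_v)` -/

open Classical in
include hw heA hϖ hg₁ hK0 hK1 hI in
set_option maxHeartbeats 4000000 in
set_option synthInstance.maxHeartbeats 400000 in
-- the `SmoothInd` carrier on `U(Φ₃)(L⁺_v)` read against the `Gqs L v`-frame of ★ PairConstants (class of ★ `K2E3BranchBDeterminantZeroDepthZero`); `@`-form: instances explicit
/-- **`Λ_1 f_w = ∫_N f_w(w₀ n) dμ = μ(N₀)`** for the normalised `(I, χ̃)`-type vector `f_w` (`f_w(1) = 0`, `f_w(w₀) = 1`) of `i(χ₁, 1)` on `U(Φ₃)(L⁺_v)` — ★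
`K2E3BranchBCasselmanPairConstants.integral_toFun_weyl_mul_eq` at `t = cmBorelTriple`, `θ(b) = χ₁(b₀₀)` (`hθ` ★ `theta_eq_one_of_mem_N`, `hS` ★ `measurableSet_setOf_coe_mem`); the
letter `hw1v` (`V := μ.real N₀`). [cite: Casselman1980, §3] [cite: Casselman1995, §6.4] [cite: Keys1984, §7 Theorem (2) p. 126] -/
theorem integral_weyl_one_eq
    (χ₁ : (LocalRing L v)ˣ →* ℂˣ) (w₀ : ↥(unitaryGroupOfForm (conjLocal L (IsCMField.complexConj L) v) (cmLocalForm L 3 v))) (hw₀ : Units.val (w₀ : GL (Fin 3) (LocalRing L v)) = cmLocalForm L 3 v)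
    [instM : MeasurableSpace ↥(cmBorelTriple L 3 v).N] [instB : BorelSpace ↥(cmBorelTriple L 3 v).N] (μ : Measure ↥(cmBorelTriple L 3 v).N)
    (f_w : haveI := locallyCompactSpace_cmBorelU L 3 v
      Representation.SmoothInd (cmBorelTriple L 3 v).P
        (Representation.twist (((Representation.trivial ℂ ↥(torusU (conjLocal L (IsCMField.complexConj L) v) (cmLocalForm L 3 v)) ℂ).twist
          (cmTorusCharPair L v χ₁ 1)).comp (cmBorelTriple L 3 v).proj) (rootDeltaChar (cmBorelTriple L 3 v).P)))
    (heig_w : ∀ x ∈ I, (haveI := locallyCompactSpace_cmBorelU L 3 v; Representation.smoothIndRep _ _ x f_w) = (if h : IsUnit (((x.val : GL (Fin 3) (LocalRing L v)) : Matrix (Fin 3) (Fin 3) (LocalRing L v)) 0 0) then ((χ₁ h.unit : ℂˣ) : ℂ) else 0) • f_w)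
    (hw1 : f_w.toFun 1 = 0) (hwg : f_w.toFun w₀ = 1) :
    ∫ n : ↥(cmBorelTriple L 3 v).N, f_w.toFun (w₀ * (n : ↥(unitaryGroupOfForm (conjLocal L (IsCMField.complexConj L) v) (cmLocalForm L 3 v))) * 1) ∂μ = ((μ.real {m : ↥(cmBorelTriple L 3 v).N | (m : ↥(unitaryGroupOfForm (conjLocal L (IsCMField.complexConj L) v) (cmLocalForm L 3 v))) ∈ I} : ℝ) : ℂ) := by
  haveI := locallyCompactSpace_cmBorelU L 3 v
  have h := @K2E3BranchBCasselmanPairConstants.integral_toFun_weyl_mul_eq L _ _ _ v w hw eA heA _ hϖ g₁ hg₁ K0 K1 I hK0 hK1 hI (cmBorelTriple L 3 v) rfl w₀ hw₀ instM μ _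
    (fun g : Gqs L v => if h : IsUnit (((g.val : GL (Fin 3) (LocalRing L v)) : Matrix (Fin 3) (Fin 3) (LocalRing L v)) 0 0) then ((χ₁ h.unit : ℂˣ) : ℂ) else 0)
    f_w heig_w hw1 hwg (fun n _ => K2E3IwahoriCellMembership.theta_eq_one_of_mem_N L v (cmBorelTriple L 3 v) rfl χ₁ n.2)
    (@K2E3BranchBHaarFactsN.measurableSet_setOf_coe_mem L _ _ _ v w hw eA g₁ K0 K1 I hK0 hK1 hI (cmBorelTriple L 3 v) instM instB)
  simp only [mul_one]
  exact h

open Classical in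
include hw heA hϖ hg₁ hK0 hK1 hI in
set_option maxHeartbeats 4000000 in
set_option synthInstance.maxHeartbeats 400000 in
-- as above
/-- **`n ↦ f_w(w₀ n)` is `μ`-integrable** for every measure finite on compacts (an indicator of `N₀`, ★ `integrable_toFun_weyl_mul`; `hfin` ★ `measure_setOf_coe_mem_lt_top`) — the
letter `hiw₁`. [cite: Casselman1995, §6.4] -/
theorem integrable_weyl_one
    (χ₁ : (LocalRing L v)ˣ →* ℂˣ) (w₀ : ↥(unitaryGroupOfForm (conjLocal L (IsCMField.complexConj L) v) (cmLocalForm L 3 v))) (hw₀ : Units.val (w₀ : GL (Fin 3) (LocalRing L v)) = cmLocalForm L 3 v)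
    [instM : MeasurableSpace ↥(cmBorelTriple L 3 v).N] [instB : BorelSpace ↥(cmBorelTriple L 3 v).N] (μ : Measure ↥(cmBorelTriple L 3 v).N)
    (f_w : haveI := locallyCompactSpace_cmBorelU L 3 v
      Representation.SmoothInd (cmBorelTriple L 3 v).P
        (Representation.twist (((Representation.trivial ℂ ↥(torusU (conjLocal L (IsCMField.complexConj L) v) (cmLocalForm L 3 v)) ℂ).twist
          (cmTorusCharPair L v χ₁ 1)).comp (cmBorelTriple L 3 v).proj) (rootDeltaChar (cmBorelTriple L 3 v).P)))
    (heig_w : ∀ x ∈ I, (haveI := locallyCompactSpace_cmBorelU L 3 v; Representation.smoothIndRep _ _ x f_w) = (if h : IsUnit (((x.val : GL (Fin 3) (LocalRing L v)) : Matrix (Fin 3) (Fin 3) (LocalRing L v)) 0 0) then ((χ₁ h.unit : ℂˣ) : ℂ) else 0) • f_w)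
    (hw1 : f_w.toFun 1 = 0) (hwg : f_w.toFun w₀ = 1) [instF : IsFiniteMeasureOnCompacts μ] :
    Integrable (fun n : ↥(cmBorelTriple L 3 v).N => f_w.toFun (w₀ * (n : ↥(unitaryGroupOfForm (conjLocal L (IsCMField.complexConj L) v) (cmLocalForm L 3 v))) * 1)) μ := by
  haveI := locallyCompactSpace_cmBorelU L 3 v
  have h := @K2E3BranchBCasselmanPairConstants.integrable_toFun_weyl_mul L _ _ _ v w hw eA heA _ hϖ g₁ hg₁ K0 K1 I hK0 hK1 hI (cmBorelTriple L 3 v) rfl w₀ hw₀ instM μ _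
    (fun g : Gqs L v => if h : IsUnit (((g.val : GL (Fin 3) (LocalRing L v)) : Matrix (Fin 3) (Fin 3) (LocalRing L v)) 0 0) then ((χ₁ h.unit : ℂˣ) : ℂ) else 0)
    f_w heig_w hw1 hwg (fun n _ => K2E3IwahoriCellMembership.theta_eq_one_of_mem_N L v (cmBorelTriple L 3 v) rfl χ₁ n.2)
    (@K2E3BranchBHaarFactsN.measurableSet_setOf_coe_mem L _ _ _ v w hw eA g₁ K0 K1 I hK0 hK1 hI (cmBorelTriple L 3 v) instM instB)
    (@K2E3BranchBHaarFactsN.measure_setOf_coe_mem_lt_top L _ _ _ v w hw eA g₁ K0 K1 I hK0 hK1 hI (cmBorelTriple L 3 v) rfl instM μ instF).ne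
  simp only [mul_one]
  exact h

/-! ## §4 `Λ_{w₀} f₁ = q⁻³·μ(N₀)` (unramified `v`) and its integrability, on `U(Φ₃)(L⁺_v)` -/

open Classical in
include hw heA hϖ hg₁ hK0 hK1 hI in
set_option maxHeartbeats 4000000 in
set_option synthInstance.maxHeartbeats 400000 in
-- as in §3
/-- **`Λ_{w₀} f₁ = ∫_N f₁(w₀ n w₀) dμ = q⁻³·μ(N₀)`** at a non-split place UNRAMIFIED in `L`, for the normalised `(I, χ̃)`-type vector `f₁` (`f₁(1) = 1`, `f₁(w₀) = 0`) of `i(χ₁, 1)`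
and a Haar `μ` — ★ `integral_toFun_conj_eq` (`hθ` ★ `theta_conj_eq_one`, `hS` ★ `measurableSet_setOf_conj_mem`) + ★ `measureReal_setOf_conj_mem_eq` (`vol N(𝔭) = q⁻³ vol N₀`);
the letter `h1wv`. [cite: Casselman1980, §3] [cite: Rogawski1990, §4.9 p. 54] [cite: Keys1984, §7 Theorem (2) p. 126] -/
theorem integral_weyl_weyl_eq
    (χ₁ : (LocalRing L v)ˣ →* ℂˣ) (w₀ : ↥(unitaryGroupOfForm (conjLocal L (IsCMField.complexConj L) v) (cmLocalForm L 3 v))) (hw₀ : Units.val (w₀ : GL (Fin 3) (LocalRing L v)) = cmLocalForm L 3 v)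
    [instM : MeasurableSpace ↥(cmBorelTriple L 3 v).N] [instB : BorelSpace ↥(cmBorelTriple L 3 v).N] (μ : Measure ↥(cmBorelTriple L 3 v).N)
    (f₁ : haveI := locallyCompactSpace_cmBorelU L 3 v
      Representation.SmoothInd (cmBorelTriple L 3 v).P
        (Representation.twist (((Representation.trivial ℂ ↥(torusU (conjLocal L (IsCMField.complexConj L) v) (cmLocalForm L 3 v)) ℂ).twist
          (cmTorusCharPair L v χ₁ 1)).comp (cmBorelTriple L 3 v).proj) (rootDeltaChar (cmBorelTriple L 3 v).P)))
    (heig₁ : ∀ x ∈ I, (haveI := locallyCompactSpace_cmBorelU L 3 v; Representation.smoothIndRep _ _ x f₁) = (if h : IsUnit (((x.val : GL (Fin 3) (LocalRing L v)) : Matrix (Fin 3) (Fin 3) (LocalRing L v)) 0 0) then ((χ₁ h.unit : ℂˣ) : ℂ) else 0) • f₁)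
    (h11 : f₁.toFun 1 = 1) (h1g : f₁.toFun w₀ = 0) [instH : μ.IsHaarMeasure] (hunr : Algebra.IsUnramifiedIn (𝓞 L) v.asIdeal) :
    ∫ n : ↥(cmBorelTriple L 3 v).N, f₁.toFun (w₀ * (n : ↥(unitaryGroupOfForm (conjLocal L (IsCMField.complexConj L) v) (cmLocalForm L 3 v))) * w₀) ∂μ = (((Ideal.absNorm v.asIdeal : ℝ) : ℂ) ^ 3)⁻¹ * ((μ.real {m : ↥(cmBorelTriple L 3 v).N | (m : ↥(unitaryGroupOfForm (conjLocal L (IsCMField.complexConj L) v) (cmLocalForm L 3 v))) ∈ I} : ℝ) : ℂ) := by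
  haveI := locallyCompactSpace_cmBorelU L 3 v
  have h := @K2E3BranchBCasselmanPairConstants.integral_toFun_conj_eq L _ _ _ v w hw eA heA _ hϖ g₁ hg₁ K0 K1 I hK0 hK1 hI (cmBorelTriple L 3 v) rfl w₀ hw₀ instM μ _
    (fun g : Gqs L v => if h : IsUnit (((g.val : GL (Fin 3) (LocalRing L v)) : Matrix (Fin 3) (Fin 3) (LocalRing L v)) 0 0) then ((χ₁ h.unit : ℂˣ) : ℂ) else 0)
    f₁ heig₁ h11 h1g (fun n _ => K2E3BranchALettersCM.theta_conj_eq_one L v w hw eA heA (cmBorelTriple L 3 v) rfl w₀ hw₀ χ₁ n.2)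
    (@K2E3BranchBHaarFactsN.measurableSet_setOf_conj_mem L _ _ _ v w hw eA g₁ K0 K1 I hK0 hK1 hI (cmBorelTriple L 3 v) w₀ instM instB)
  rw [K2E3BranchBHaarFactsN.measureReal_setOf_conj_mem_eq L v w hw eA heA hϖ g₁ hg₁ K0 K1 I hK0 hK1 hI (cmBorelTriple L 3 v) rfl w₀ hw₀ μ
    (instM := instM) (instB := instB) (instH := instH) hunr] at h
  refine h.trans ?_
  push_cast
  -- the two spellings of `N₀` (`Gqs L v` ∕ `U(Φ₃)(L⁺_v)` coercions) agree definitionally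
  rfl

open Classical in
include hw heA hϖ hg₁ hK0 hK1 hI in
set_option maxHeartbeats 4000000 in
set_option synthInstance.maxHeartbeats 400000 in
-- as in §3
/-- **`n ↦ f₁(w₀ n w₀)` is `μ`-integrable** for every measure finite on compacts (an indicator of `N(𝔭) = {w₀ n w₀ ∈ I}`, ★ `integrable_toFun_conj`; `hfin` ★
`measure_setOf_conj_mem_lt_top`) — the letter `hi₁₂`. [cite: Casselman1995, §6.4] -/
theorem integrable_weyl_weyl
    (χ₁ : (LocalRing L v)ˣ →* ℂˣ) (w₀ : ↥(unitaryGroupOfForm (conjLocal L (IsCMField.complexConj L) v) (cmLocalForm L 3 v))) (hw₀ : Units.val (w₀ : GL (Fin 3) (LocalRing L v)) = cmLocalForm L 3 v)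
    [instM : MeasurableSpace ↥(cmBorelTriple L 3 v).N] [instB : BorelSpace ↥(cmBorelTriple L 3 v).N] (μ : Measure ↥(cmBorelTriple L 3 v).N)
    (f₁ : haveI := locallyCompactSpace_cmBorelU L 3 v
      Representation.SmoothInd (cmBorelTriple L 3 v).P
        (Representation.twist (((Representation.trivial ℂ ↥(torusU (conjLocal L (IsCMField.complexConj L) v) (cmLocalForm L 3 v)) ℂ).twist
          (cmTorusCharPair L v χ₁ 1)).comp (cmBorelTriple L 3 v).proj) (rootDeltaChar (cmBorelTriple L 3 v).P)))
    (heig₁ : ∀ x ∈ I, (haveI := locallyCompactSpace_cmBorelU L 3 v; Representation.smoothIndRep _ _ x f₁) = (if h : IsUnit (((x.val : GL (Fin 3) (LocalRing L v)) : Matrix (Fin 3) (Fin 3) (LocalRing L v)) 0 0) then ((χ₁ h.unit : ℂˣ) : ℂ) else 0) • f₁)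
    (h11 : f₁.toFun 1 = 1) (h1g : f₁.toFun w₀ = 0) [instF : IsFiniteMeasureOnCompacts μ] :
    Integrable (fun n : ↥(cmBorelTriple L 3 v).N => f₁.toFun (w₀ * (n : ↥(unitaryGroupOfForm (conjLocal L (IsCMField.complexConj L) v) (cmLocalForm L 3 v))) * w₀)) μ := by
  haveI := locallyCompactSpace_cmBorelU L 3 v
  exact @K2E3BranchBCasselmanPairConstants.integrable_toFun_conj L _ _ _ v w hw eA heA _ hϖ g₁ hg₁ K0 K1 I hK0 hK1 hI (cmBorelTriple L 3 v) rfl w₀ hw₀ instM μ _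
    (fun g : Gqs L v => if h : IsUnit (((g.val : GL (Fin 3) (LocalRing L v)) : Matrix (Fin 3) (Fin 3) (LocalRing L v)) 0 0) then ((χ₁ h.unit : ℂˣ) : ℂ) else 0)
    f₁ heig₁ h11 h1g (fun n _ => K2E3BranchALettersCM.theta_conj_eq_one L v w hw eA heA (cmBorelTriple L 3 v) rfl w₀ hw₀ χ₁ n.2)
    (@K2E3BranchBHaarFactsN.measurableSet_setOf_conj_mem L _ _ _ v w hw eA g₁ K0 K1 I hK0 hK1 hI (cmBorelTriple L 3 v) w₀ instM instB)
    (@K2E3BranchBHaarFactsN.measure_setOf_conj_mem_lt_top L _ _ _ v w hw eA g₁ K0 K1 I hK0 hK1 hI (cmBorelTriple L 3 v) rfl w₀ instM μ instF).ne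

end Summit.HodgeConjecture.HodgeConjecture.Cruxes.H413.K2E3KeysThmTwoDepthZeroBranchBConstants

end
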